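import Mathlib
import Literature.NumberTheory.Transcendental.RoyCriterion
import Literature.NumberTheory.Transcendental.RoyCriterionProp3Proofs
import Literature.NumberTheory.Transcendental.AxSchanuel

/-!
# Sketch — crux-ideate stmt-Schanuel-0078 (RoyThesis), ideator k=1, round 1

First lemmas of the idea card `transversal-max-defect` and the skeleton normal form forced by
finding F1 (the hypothesis of Roy's Conjecture 2 is y-free: `royHypothesis_exp'`).
-/

noncomputable section

open Literature.NumberTheory.Transcendental Complex

namespace Summit.Schanuel.Schanuel.Cruxes.RoyThesis.TransversalMaxDefect

/-- SKELETON NORMAL FORM (finding F1): every line for this crux ends in `∀ n, SchanuelRank n`;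
the glue to the crux decl is already a theorem in tree. -/
theorem royThesis_of_schanuelRank (h : ∀ n, SchanuelRank n) : ∀ n, RoyCriterion n :=
  fun n => (Roy2001_iff_holds n).mpr (h n)

/-- … and conversely, so nothing is lost. -/
theorem schanuelRank_of_royThesis (h : ∀ n, RoyCriterion n) : ∀ n, SchanuelRank n :=
  fun n => (Roy2001_iff_holds n).mp (h n)

/-- The y-freeness itself (finding F1), as it sits in tree: the hypothesis of Conjecture 2 holds
on the exponential graph for every `y` and every admissible parameter choice. -/
example {l : ℕ} (y : Fin l → ℂ) {s₀ s₁ t₀ t₁ u : ℝ} (h : RoyAdmissible s₀ s₁ t₀ t₁ u) :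
    RoyHypothesis y (cexp ∘ y) s₀ s₁ t₀ t₁ u :=
  royHypothesis_exp' y h

/-- FIRST LEMMA of card `transversal-max-defect` (Ax-descent / defect increase under tangency).
Abstract form over any field of characteristic `0` carrying one derivation `D`:
if `(y, z)` is an exp-compatible configuration (`D zᵢ = zᵢ D yᵢ`, `zᵢ ≠ 0`), `y` is `ℚ`-linearly
independent and `D` MOVES the configuration (`∃ i, D yᵢ ≠ 0`), then inside the constants of `D`
there is an exp-compatible sub-configuration `(u, w)` — integer combinations `u = q·y`,
`w = z^q` — whose Schanuel defect `s − trdeg ℚ(u,w)` exceeds the ambient defect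
`n − trdeg_ℚ K` by at least one.  Proof plan: Ax's theorem (`ax_schanuel`, proved in tree as
`ax_schanuel_holds`) applied to a complement of `U := span_ℚ(y) ∩ C` modulo `C = ker D`,
plus `trdeg_C C(S) ≤ trdeg_ℚ ℚ(S)`, `trdeg_ℚ K = trdeg_ℚ C + trdeg_C K`, and `ℚ(u,w) ⊆ C`. -/
theorem defect_descent (K : Type) [Field K] [CharZero K] (n : ℕ) (D : Derivation ℤ K K)
    (y z : Fin n → K) (hz : ∀ i, z i ≠ 0) (hD : ∀ i, D (z i) = z i * D (y i))
    (hy : LinearIndependent ℚ y) (hmove : ∃ i, D (y i) ≠ 0)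
    (hfin : Algebra.trdeg ℚ K < Cardinal.aleph0) :
    ∃ (s : ℕ) (q : Fin s → Fin n → ℤ),
      LinearIndependent ℤ q ∧
      (∀ i, D (∑ k, (q i k : K) * y k) = 0) ∧
      (∀ i, D (∏ k, z k ^ q i k) = 0) ∧
      (n : Cardinal) + 1 +
          Algebra.trdeg ℚ (Algebra.adjoin ℚ
            (Set.range (fun i => ∑ k, (q i k : K) * y k) ∪
             Set.range (fun i => ∏ k, z k ^ q i k)))
        ≤ (s : Cardinal) + Algebra.trdeg ℚ K := by
  sorry

/-- COROLLARY SHAPE (normal form): iterating `defect_descent` (defect ↑, ambient trdeg ↓) ends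
either at a configuration moved by NO exp-compatible derivation of its own field
("transversal": `rank_F η = t`) or at `trdeg = 0`, excluded by Hermite–Lindemann.  Stated here
for subfields of `ℂ` with `z = exp ∘ y`: a counterexample of maximal defect admits no moving
exp-compatible `ℤ`-derivation of the field it generates. -/
def MaxDefectIsTransversal : Prop :=
  ∀ (n : ℕ) (y : Fin n → ℂ), LinearIndependent ℚ y →
    let K := IntermediateField.adjoin ℚ (Set.range y ∪ Set.range (cexp ∘ y))
    -- maximal defect among exp-sub-configurations of K:
    (∀ (s : ℕ) (u : Fin s → ℂ), LinearIndependent ℚ u → (∀ i, u i ∈ K) → (∀ i, cexp (u i) ∈ K) →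
        (s : Cardinal) + Algebra.trdeg ℚ K ≤
          (n : Cardinal) + Algebra.trdeg ℚ
            (IntermediateField.adjoin ℚ (Set.range u ∪ Set.range (cexp ∘ u)))) →
    ∀ (D : Derivation ℤ K K) (y' z' : Fin n → K),
      (∀ i, (y' i : ℂ) = y i) → (∀ i, (z' i : ℂ) = cexp (y i)) →
      (∀ i, D (z' i) = z' i * D (y' i)) → ∀ i, D (y' i) = 0

end Summit.Schanuel.Schanuel.Cruxes.RoyThesis.TransversalMaxDefect

end
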